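import Summits.FinalStateConjecture.FinalStateConjecture.Theorems.BartnikGapSettlingCaptureStubHoleCount
import Summits.FinalStateConjecture.FinalStateConjecture.Theorems.BartnikGapSettlingCaptureStubPinning
import Summits.FinalStateConjecture.FinalStateConjecture.Theorems.BartnikGapSettlingCaptureStubPhantomSucc
import Summits.FinalStateConjecture.FinalStateConjecture.Statement
import HarnessLib

/-!
# Crux `Capture` (stmt-FinalStateConjecture-10115) is EQUIVALENT to pinned capture; its sectors nest

The crux `Capture` (routes `BartnikGapSettling` / `QuietWindowCapture` of summit `FinalStateConjecture`,
same body) reads, over `CauchyDevelopment.IsNearKerrLeaf`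
(`Literature/Geometry/Lorentzian/NearKerrLeaf.lean`): an MGHD `𝒟` of an admissible datum with
complete `𝓘⁺` which has NEAR-SUBEXTREMAL-KERR LEAVES — a tuple `(N₀, m₀ > 0, χ < 1, k₁, ε₁ > 0)` such
that for every `(k, ε > 0, K compact)` there is an `(ε, k)`-near-Kerr leaf beyond `J⁻(K)` with
`N ≤ N₀` holes, masses in `[m₀, m₀⁻¹]`, and the margin `|aᵢ| ≤ χ Mᵢ` once `k₁ ≤ k`, `ε ≤ ε₁` —
settles (a `C²` `FinalStateDecomposition` of the self-determined exterior with sub-extremal holes and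
exhaustive charts).  The line skeleton `Cruxes/Capture/Lines/Sketch.lean` reduces the crux to ONE
engine statement, PINNED CAPTURE: an MGHD with, for a FIXED hole count `N` and FIXED sub-extremal
positive labels `(M⋆, a⋆)`, `N`-hole `(ε, k)`-near-Kerr leaves beyond every `J⁻(K)` whose labels are
`η`-close to `(M⋆, a⋆)`, for every `(η, k, ε, K)`, settles.

This file records, free of the route files (so that closing files may import it), the two facts the
planners need in order to promote / re-line the engine:

* `capture_iff_pinnedCapture` — the crux (its body written over `IsNearKerrLeaf`, definitionally the
  route decl) is EQUIVALENT to pinned capture.  `←` is the skeleton's composition through the landed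
  normal-form theorems `stub_holeCount` (one hole count serves every `(k, ε, K)`) and `stub_pinning`
  (labels pin to one point of the compact window); `→` feeds pinned leaves to the crux with the
  explicit tuple `(N₀, m₀, χ, k₁, ε₁) = (N, m₀, χ, 0, 1)` built from the sub-extremal gap
  `η = minᵢ (M⋆ᵢ − |a⋆ᵢ|)/4`: labels `η`-close to `(M⋆, a⋆)` lie in `[m₀, m₀⁻¹]` for
  `m₀ = minᵢ min (M⋆ᵢ − η) (M⋆ᵢ + η)⁻¹` and satisfy `|aᵢ| ≤ χ Mᵢ` for
  `χ = maxᵢ (|a⋆ᵢ| + η)/(M⋆ᵢ − η) < 1`.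
* `pinnedCaptureAt_of_succ` — the sectors NEST DOWNWARD: pinned capture at hole count `N + 1`
  implies pinned capture at hole count `N`, because pinned `N`-hole leaves are pinned `(N+1)`-hole
  leaves with a phantom Schwarzschild label `(1, 0)` (landed `stub_phantomSucc`).  Hence "split the
  engine by `N`" never yields independent items: the multi-hole sector contains the one-hole and the
  dispersal sectors.

No definitions, no named facts; everything is stated expanded over importable declarations.

References: Dafermos–Rodnianski arXiv:0811.0354, Conj. 5.1 (the `N = 1` sector is sub-extremal Kerr
stability in leaf form); Dafermos–Holzegel–Rodnianski–Taylor arXiv:2104.08222, §1 (leaf vocabulary).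
-/

-- the doubled `FinalStateConjecture.FinalStateConjecture` path component trips dupNamespace
set_option linter.dupNamespace false

noncomputable section

namespace Summit.FinalStateConjecture.FinalStateConjecture.Theorems.BartnikGapSettling.Capture

open Set Filter Topology
open scoped Manifold ContDiff ENNReal
open Literature.Geometry.Lorentzian

/-- **Pinned capture implies the crux** (the composition of line `Sketch`): stabilise the hole count
(`stub_holeCount`), pin the labels (`stub_pinning`), observe that pinned labels in the window with the
margin are positive and sub-extremal (`0 < m₀ ≤ M⋆ᵢ`, `|a⋆ᵢ| ≤ χ M⋆ᵢ < M⋆ᵢ`), and capture.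
[folklore] -/
theorem capture_of_pinnedCapture
    (h : ∀ (X : Type) [TopologicalSpace X] [ChartedSpace E3 X] [IsManifold (𝓡 3) ∞ X] [T2Space X]
      [SecondCountableTopology X] [ConnectedSpace X],
      ∀ D ∈ admissibleVacuumData X, ∀ 𝒟 : VacuumCauchyDevelopment D, 𝒟.IsMaximal →
        Summit.FinalStateConjecture.HasCompleteNullInfinity 𝒟.toCauchyDevelopment →
          ∀ (N : ℕ) (M₀ a₀ : Fin N → ℝ), (∀ i, 0 < M₀ i ∧ |a₀ i| < M₀ i) →
            (∀ η : ℝ, 0 < η → ∀ (k : ℕ) (ε : ℝ≥0∞), 0 < ε → ∀ K : Set 𝒟.carrier, IsCompact K →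
              ∃ (M a : Fin N → ℝ) (S : Set 𝒟.carrier),
                (∀ i, |M i - M₀ i| ≤ η ∧ |a i - a₀ i| ≤ η) ∧
                  Disjoint S (𝒟.metric.causalPast 𝒟.timeOrientation K) ∧
                    𝒟.toCauchyDevelopment.IsNearKerrLeaf k ε N M a S) →
            ∃ (O : Set 𝒟.carrier) (d : FinalStateDecomposition 𝒟.toSpacetime O 2),
              (∀ i, Kerr.IsSubextremal (d.mass i) (d.spin i)) ∧
                O = Summit.FinalStateConjecture.exteriorOf 𝒟.toCauchyDevelopment d.charted ∧
                  Summit.FinalStateConjecture.HasExhaustiveCharts d) :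
    ∀ (X : Type) [TopologicalSpace X] [ChartedSpace E3 X] [IsManifold (𝓡 3) ∞ X] [T2Space X]
      [SecondCountableTopology X] [ConnectedSpace X],
      ∀ D ∈ admissibleVacuumData X, ∀ 𝒟 : VacuumCauchyDevelopment D, 𝒟.IsMaximal →
        Summit.FinalStateConjecture.HasCompleteNullInfinity 𝒟.toCauchyDevelopment →
          (∃ (N₀ : ℕ) (m₀ χ : ℝ) (k₁ : ℕ) (ε₁ : ℝ≥0∞), 0 < m₀ ∧ χ < 1 ∧ 0 < ε₁ ∧
            ∀ (k : ℕ) (ε : ℝ≥0∞), 0 < ε → ∀ K : Set 𝒟.carrier, IsCompact K →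
              ∃ (N : ℕ) (M a : Fin N → ℝ) (S : Set 𝒟.carrier), N ≤ N₀ ∧
                (∀ i, m₀ ≤ M i ∧ M i ≤ m₀⁻¹) ∧
                  Disjoint S (𝒟.metric.causalPast 𝒟.timeOrientation K) ∧
                    𝒟.toCauchyDevelopment.IsNearKerrLeaf k ε N M a S ∧
                      (k₁ ≤ k → ε ≤ ε₁ → ∀ i, |a i| ≤ χ * M i)) →
            ∃ (O : Set 𝒟.carrier) (d : FinalStateDecomposition 𝒟.toSpacetime O 2),
              (∀ i, Kerr.IsSubextremal (d.mass i) (d.spin i)) ∧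
                O = Summit.FinalStateConjecture.exteriorOf 𝒟.toCauchyDevelopment d.charted ∧
                  Summit.FinalStateConjecture.HasExhaustiveCharts d := by
  intro X _ _ _ _ _ _ D hD 𝒟 hmax hCNI hyp
  obtain ⟨N₀, m₀, χ, k₁, ε₁, hm₀, hχ, hε₁, H⟩ := hyp
  obtain ⟨N, -, HN⟩ := stub_holeCount X D 𝒟 N₀ m₀ χ k₁ ε₁ hε₁ H
  obtain ⟨M₀, a₀, hwin, hpin⟩ := stub_pinning X D 𝒟 N m₀ χ HN
  refine h X D hD 𝒟 hmax hCNI N M₀ a₀ (fun i ↦ ?_) hpin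
  obtain ⟨hlo, -, hspin⟩ := hwin i
  have hM : 0 < M₀ i := hm₀.trans_le hlo
  exact ⟨hM, hspin.trans_lt (by nlinarith)⟩

/-- **The crux implies pinned capture**: pinned `N`-hole leaves at sub-extremal positive labels
`(M⋆, a⋆)` are near-sub-extremal-Kerr leaves for the explicit tuple
`(N₀, m₀, χ, k₁, ε₁) = (N, minᵢ min (M⋆ᵢ − η) (M⋆ᵢ + η)⁻¹, maxᵢ (|a⋆ᵢ| + η)/(M⋆ᵢ − η), 0, 1)` with
the gap `η = minᵢ (M⋆ᵢ − |a⋆ᵢ|)/4` (everything vacuous for `N = 0`). [folklore] -/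
theorem pinnedCapture_of_capture
    (h : ∀ (X : Type) [TopologicalSpace X] [ChartedSpace E3 X] [IsManifold (𝓡 3) ∞ X] [T2Space X]
      [SecondCountableTopology X] [ConnectedSpace X],
      ∀ D ∈ admissibleVacuumData X, ∀ 𝒟 : VacuumCauchyDevelopment D, 𝒟.IsMaximal →
        Summit.FinalStateConjecture.HasCompleteNullInfinity 𝒟.toCauchyDevelopment →
          (∃ (N₀ : ℕ) (m₀ χ : ℝ) (k₁ : ℕ) (ε₁ : ℝ≥0∞), 0 < m₀ ∧ χ < 1 ∧ 0 < ε₁ ∧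
            ∀ (k : ℕ) (ε : ℝ≥0∞), 0 < ε → ∀ K : Set 𝒟.carrier, IsCompact K →
              ∃ (N : ℕ) (M a : Fin N → ℝ) (S : Set 𝒟.carrier), N ≤ N₀ ∧
                (∀ i, m₀ ≤ M i ∧ M i ≤ m₀⁻¹) ∧
                  Disjoint S (𝒟.metric.causalPast 𝒟.timeOrientation K) ∧
                    𝒟.toCauchyDevelopment.IsNearKerrLeaf k ε N M a S ∧
                      (k₁ ≤ k → ε ≤ ε₁ → ∀ i, |a i| ≤ χ * M i)) →
            ∃ (O : Set 𝒟.carrier) (d : FinalStateDecomposition 𝒟.toSpacetime O 2),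
              (∀ i, Kerr.IsSubextremal (d.mass i) (d.spin i)) ∧
                O = Summit.FinalStateConjecture.exteriorOf 𝒟.toCauchyDevelopment d.charted ∧
                  Summit.FinalStateConjecture.HasExhaustiveCharts d) :
    ∀ (X : Type) [TopologicalSpace X] [ChartedSpace E3 X] [IsManifold (𝓡 3) ∞ X] [T2Space X]
      [SecondCountableTopology X] [ConnectedSpace X],
      ∀ D ∈ admissibleVacuumData X, ∀ 𝒟 : VacuumCauchyDevelopment D, 𝒟.IsMaximal →
        Summit.FinalStateConjecture.HasCompleteNullInfinity 𝒟.toCauchyDevelopment →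
          ∀ (N : ℕ) (M₀ a₀ : Fin N → ℝ), (∀ i, 0 < M₀ i ∧ |a₀ i| < M₀ i) →
            (∀ η : ℝ, 0 < η → ∀ (k : ℕ) (ε : ℝ≥0∞), 0 < ε → ∀ K : Set 𝒟.carrier, IsCompact K →
              ∃ (M a : Fin N → ℝ) (S : Set 𝒟.carrier),
                (∀ i, |M i - M₀ i| ≤ η ∧ |a i - a₀ i| ≤ η) ∧
                  Disjoint S (𝒟.metric.causalPast 𝒟.timeOrientation K) ∧
                    𝒟.toCauchyDevelopment.IsNearKerrLeaf k ε N M a S) →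
            ∃ (O : Set 𝒟.carrier) (d : FinalStateDecomposition 𝒟.toSpacetime O 2),
              (∀ i, Kerr.IsSubextremal (d.mass i) (d.spin i)) ∧
                O = Summit.FinalStateConjecture.exteriorOf 𝒟.toCauchyDevelopment d.charted ∧
                  Summit.FinalStateConjecture.HasExhaustiveCharts d := by
  intro X _ _ _ _ _ _ D hD 𝒟 hmax hCNI N M₀ a₀ hsub hpin
  refine h X D hD 𝒟 hmax hCNI ?_
  rcases Nat.eq_zero_or_pos N with rfl | hN
  · refine ⟨0, 1, 0, 0, 1, one_pos, one_pos, one_pos, fun k ε hε K hK ↦ ?_⟩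
    obtain ⟨M, a, S, -, hdisj, hleaf⟩ := hpin 1 one_pos k ε hε K hK
    exact ⟨0, M, a, S, le_rfl, fun i ↦ i.elim0, hdisj, hleaf, fun _ _ i ↦ i.elim0⟩
  · haveI : Nonempty (Fin N) := ⟨⟨0, hN⟩⟩
    -- the gap `η`
    obtain ⟨i₀, hi₀⟩ := Finite.exists_min fun i ↦ M₀ i - |a₀ i|
    set η : ℝ := (M₀ i₀ - |a₀ i₀|) / 4 with hη
    have hgap : ∀ i, 4 * η ≤ M₀ i - |a₀ i| := fun i ↦ by
      have := hi₀ i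
      rw [hη]
      linarith
    have hηpos : 0 < η := by
      have := (hsub i₀).2
      rw [hη]
      linarith
    have hlo : ∀ i, 0 < M₀ i - η := fun i ↦ by
      linarith [hgap i, abs_nonneg (a₀ i), hηpos]
    have hhi : ∀ i, 0 < M₀ i + η := fun i ↦ by linarith [(hsub i).1, hηpos]
    -- the window `m₀`
    obtain ⟨i₁, hi₁⟩ := Finite.exists_min fun i ↦ min (M₀ i - η) (M₀ i + η)⁻¹
    set m₀ : ℝ := min (M₀ i₁ - η) (M₀ i₁ + η)⁻¹ with hm₀
    have hm₀pos : 0 < m₀ := lt_min (hlo i₁) (inv_pos.2 (hhi i₁))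
    -- the margin `χ`
    obtain ⟨i₂, hi₂⟩ := Finite.exists_max fun i ↦ (|a₀ i| + η) / (M₀ i - η)
    set χ : ℝ := (|a₀ i₂| + η) / (M₀ i₂ - η) with hχ
    have hχlt : χ < 1 := by
      rw [hχ, div_lt_one (hlo i₂)]
      linarith [hgap i₂]
    have hχnn : 0 ≤ χ := div_nonneg (by positivity) (hlo i₂).le
    refine ⟨N, m₀, χ, 0, 1, hm₀pos, hχlt, one_pos, fun k ε hε K hK ↦ ?_⟩
    obtain ⟨M, a, S, hcl, hdisj, hleaf⟩ := hpin η hηpos k ε hε K hK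
    have hMlo : ∀ i, M₀ i - η ≤ M i := fun i ↦ by linarith [(abs_le.1 (hcl i).1).1]
    have hMhi : ∀ i, M i ≤ M₀ i + η := fun i ↦ by linarith [(abs_le.1 (hcl i).1).2]
    refine ⟨N, M, a, S, le_rfl, fun i ↦ ⟨?_, ?_⟩, hdisj, hleaf, fun _ _ i ↦ ?_⟩
    · exact ((hi₁ i).trans (min_le_left _ _)).trans (hMlo i)
    · have h1 : m₀ ≤ (M₀ i + η)⁻¹ := (hi₁ i).trans (min_le_right _ _)
      exact (hMhi i).trans ((le_inv_comm₀ hm₀pos (hhi i)).1 h1)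
    · have hai : |a i| ≤ |a₀ i| + η := by
        have := (hcl i).2
        have h' : |a i| - |a₀ i| ≤ |a i - a₀ i| := abs_sub_abs_le_abs_sub _ _
        linarith
      have hci : (|a₀ i| + η) / (M₀ i - η) ≤ χ := hi₂ i
      calc |a i| ≤ |a₀ i| + η := hai
        _ = (|a₀ i| + η) / (M₀ i - η) * (M₀ i - η) := by rw [div_mul_cancel₀ _ (hlo i).ne']
        _ ≤ χ * (M₀ i - η) := by gcongr; exact (hlo i).le
        _ ≤ χ * M i := by gcongr; exact hMlo i

/-- **The crux `Capture` is equivalent to pinned capture** (its body over `IsNearKerrLeaf`,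
definitionally the route decls `…Theses.QuietWindowCapture.Capture` / `…Theses.BartnikGapSettling.Capture`):
the line skeleton `Cruxes/Capture/Lines/Sketch.lean` splits off exactly the bookkeeping binders
`(N₀, m₀, χ, k₁, ε₁)`; its one open stub `stub_pinnedCapture` is the crux itself in normal form.
[folklore] -/
theorem capture_iff_pinnedCapture :
    (∀ (X : Type) [TopologicalSpace X] [ChartedSpace E3 X] [IsManifold (𝓡 3) ∞ X] [T2Space X]
      [SecondCountableTopology X] [ConnectedSpace X],
      ∀ D ∈ admissibleVacuumData X, ∀ 𝒟 : VacuumCauchyDevelopment D, 𝒟.IsMaximal →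
        Summit.FinalStateConjecture.HasCompleteNullInfinity 𝒟.toCauchyDevelopment →
          (∃ (N₀ : ℕ) (m₀ χ : ℝ) (k₁ : ℕ) (ε₁ : ℝ≥0∞), 0 < m₀ ∧ χ < 1 ∧ 0 < ε₁ ∧
            ∀ (k : ℕ) (ε : ℝ≥0∞), 0 < ε → ∀ K : Set 𝒟.carrier, IsCompact K →
              ∃ (N : ℕ) (M a : Fin N → ℝ) (S : Set 𝒟.carrier), N ≤ N₀ ∧
                (∀ i, m₀ ≤ M i ∧ M i ≤ m₀⁻¹) ∧
                  Disjoint S (𝒟.metric.causalPast 𝒟.timeOrientation K) ∧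
                    𝒟.toCauchyDevelopment.IsNearKerrLeaf k ε N M a S ∧
                      (k₁ ≤ k → ε ≤ ε₁ → ∀ i, |a i| ≤ χ * M i)) →
            ∃ (O : Set 𝒟.carrier) (d : FinalStateDecomposition 𝒟.toSpacetime O 2),
              (∀ i, Kerr.IsSubextremal (d.mass i) (d.spin i)) ∧
                O = Summit.FinalStateConjecture.exteriorOf 𝒟.toCauchyDevelopment d.charted ∧
                  Summit.FinalStateConjecture.HasExhaustiveCharts d) ↔
    ∀ (X : Type) [TopologicalSpace X] [ChartedSpace E3 X] [IsManifold (𝓡 3) ∞ X] [T2Space X]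
      [SecondCountableTopology X] [ConnectedSpace X],
      ∀ D ∈ admissibleVacuumData X, ∀ 𝒟 : VacuumCauchyDevelopment D, 𝒟.IsMaximal →
        Summit.FinalStateConjecture.HasCompleteNullInfinity 𝒟.toCauchyDevelopment →
          ∀ (N : ℕ) (M₀ a₀ : Fin N → ℝ), (∀ i, 0 < M₀ i ∧ |a₀ i| < M₀ i) →
            (∀ η : ℝ, 0 < η → ∀ (k : ℕ) (ε : ℝ≥0∞), 0 < ε → ∀ K : Set 𝒟.carrier, IsCompact K →
              ∃ (M a : Fin N → ℝ) (S : Set 𝒟.carrier),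
                (∀ i, |M i - M₀ i| ≤ η ∧ |a i - a₀ i| ≤ η) ∧
                  Disjoint S (𝒟.metric.causalPast 𝒟.timeOrientation K) ∧
                    𝒟.toCauchyDevelopment.IsNearKerrLeaf k ε N M a S) →
            ∃ (O : Set 𝒟.carrier) (d : FinalStateDecomposition 𝒟.toSpacetime O 2),
              (∀ i, Kerr.IsSubextremal (d.mass i) (d.spin i)) ∧
                O = Summit.FinalStateConjecture.exteriorOf 𝒟.toCauchyDevelopment d.charted ∧
                  Summit.FinalStateConjecture.HasExhaustiveCharts d :=
  ⟨fun h ↦ pinnedCapture_of_capture h, fun h ↦ capture_of_pinnedCapture h⟩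

/-- **The sectors of pinned capture nest downward**: pinned capture at hole count `N + 1` implies
pinned capture at hole count `N` — pad the pinned labels `(M⋆, a⋆)` with the phantom Schwarzschild
label `(1, 0)` at index `0`; pinned `N`-hole leaves are pinned `(N+1)`-hole leaves with that label
(`stub_phantomSucc`: the phantom's disc is empty, its chart bends a far cap of the hyperboloidal leaf).
Hence the multi-hole sector of the crux contains its one-hole and dispersal sectors. [folklore] -/
theorem pinnedCaptureAt_of_succ (N : ℕ)
    (h : ∀ (X : Type) [TopologicalSpace X] [ChartedSpace E3 X] [IsManifold (𝓡 3) ∞ X] [T2Space X]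
      [SecondCountableTopology X] [ConnectedSpace X],
      ∀ D ∈ admissibleVacuumData X, ∀ 𝒟 : VacuumCauchyDevelopment D, 𝒟.IsMaximal →
        Summit.FinalStateConjecture.HasCompleteNullInfinity 𝒟.toCauchyDevelopment →
          ∀ (M₀ a₀ : Fin (N + 1) → ℝ), (∀ i, 0 < M₀ i ∧ |a₀ i| < M₀ i) →
            (∀ η : ℝ, 0 < η → ∀ (k : ℕ) (ε : ℝ≥0∞), 0 < ε → ∀ K : Set 𝒟.carrier, IsCompact K →
              ∃ (M a : Fin (N + 1) → ℝ) (S : Set 𝒟.carrier),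
                (∀ i, |M i - M₀ i| ≤ η ∧ |a i - a₀ i| ≤ η) ∧
                  Disjoint S (𝒟.metric.causalPast 𝒟.timeOrientation K) ∧
                    𝒟.toCauchyDevelopment.IsNearKerrLeaf k ε (N + 1) M a S) →
            ∃ (O : Set 𝒟.carrier) (d : FinalStateDecomposition 𝒟.toSpacetime O 2),
              (∀ i, Kerr.IsSubextremal (d.mass i) (d.spin i)) ∧
                O = Summit.FinalStateConjecture.exteriorOf 𝒟.toCauchyDevelopment d.charted ∧
                  Summit.FinalStateConjecture.HasExhaustiveCharts d) :
    ∀ (X : Type) [TopologicalSpace X] [ChartedSpace E3 X] [IsManifold (𝓡 3) ∞ X] [T2Space X]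
      [SecondCountableTopology X] [ConnectedSpace X],
      ∀ D ∈ admissibleVacuumData X, ∀ 𝒟 : VacuumCauchyDevelopment D, 𝒟.IsMaximal →
        Summit.FinalStateConjecture.HasCompleteNullInfinity 𝒟.toCauchyDevelopment →
          ∀ (M₀ a₀ : Fin N → ℝ), (∀ i, 0 < M₀ i ∧ |a₀ i| < M₀ i) →
            (∀ η : ℝ, 0 < η → ∀ (k : ℕ) (ε : ℝ≥0∞), 0 < ε → ∀ K : Set 𝒟.carrier, IsCompact K →
              ∃ (M a : Fin N → ℝ) (S : Set 𝒟.carrier),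
                (∀ i, |M i - M₀ i| ≤ η ∧ |a i - a₀ i| ≤ η) ∧
                  Disjoint S (𝒟.metric.causalPast 𝒟.timeOrientation K) ∧
                    𝒟.toCauchyDevelopment.IsNearKerrLeaf k ε N M a S) →
            ∃ (O : Set 𝒟.carrier) (d : FinalStateDecomposition 𝒟.toSpacetime O 2),
              (∀ i, Kerr.IsSubextremal (d.mass i) (d.spin i)) ∧
                O = Summit.FinalStateConjecture.exteriorOf 𝒟.toCauchyDevelopment d.charted ∧
                  Summit.FinalStateConjecture.HasExhaustiveCharts d := by
  intro X _ _ _ _ _ _ D hD 𝒟 hmax hCNI M₀ a₀ hsub hpin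
  refine h X D hD 𝒟 hmax hCNI (Matrix.vecCons 1 M₀) (Matrix.vecCons 0 a₀) (fun i ↦ ?_)
    fun η hη k ε hε K hK ↦ ?_
  · refine Fin.cases ?_ (fun j ↦ ?_) i
    · simp
    · simpa using hsub j
  · obtain ⟨M, a, S, hcl, hdisj, hleaf⟩ := hpin η hη k ε hε K hK
    refine ⟨Matrix.vecCons 1 M, Matrix.vecCons 0 a, S, fun i ↦ ?_, hdisj,
      stub_phantomSucc X D 𝒟.toCauchyDevelopment k ε N M a S 1 one_pos hleaf⟩
    refine Fin.cases ?_ (fun j ↦ ?_) i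
    · simp [hη.le]
    · simpa using hcl j

end Summit.FinalStateConjecture.FinalStateConjecture.Theorems.BartnikGapSettling.Capture

end
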